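import Summits.HodgeConjecture.CorCM.Census.BaseBlockNearTypes

/-!
# The quaternion column, I: the biarc types of `Q_{4n}` — base changes, flips, and the biarc faces

COR-CM (cell `pub-hodgecm2`), count-neutral kernel combinatorics by the binder seat b09 (gen 39; lane QUATERNION COLUMN = the
successor pointer of `HOME/pub-hodgecm2-b09/lean-g38/SPLITTING-METHOD.md` §WHAT IS LEFT (1)), part I = the MODEL, in the abstract currency
of `CorCM/Prior/AllgGroup1.lean` (`CMF`, `oflipCM`, `gface`, `gfaceSet`) and `Census/BlockParityLaw.lean` (`rt`); the `ℤ/2n`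
arithmetic of `Census/TwistGenerationModel.lean` (`val_add_n`, `lt_iff_not_lt_add_n`) is used BY NAME.  Bookkeeping definitions with bodies
(`c`, `idx`, `isA`, `barcSet`, `barc`, `fplus`) + theorems; no `decide` beyond closed identities, no certificate, no named fact, no `sorry`.
HONEST FRAMING: `HC_CM` is NOT proved, here or anywhere in the tree; nothing here is a period or a headline.

THE SETTING.  `G = QuaternionGroup n = ⟨a 1, xa 0⟩` (Mathlib: `a i * a j = a (i+j)`, `a i * xa j = xa (j−i)`, `xa i * a j = xa (i+j)`,
`xa i * xa j = a (n+j−i)`), of order `4n`, with its central involution `c = a n` (`= x²`; for `n = 2^m` the unique involution).  A CM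
type of `(G, c)` contains exactly one of `g`, `c·g` for every `g`; the **biarc types**
`barc p q = {a p, a (p+1), …, a (p+n−1)} ⊔ {xa q, …, xa (q+n−1)}` (`p q : ℤ/2n`) are the types both of whose halves are arcs — the
standard type of part F (`Nondegenerate.nondegenerate_arc_double`) is `T₀ = barc 0 0`, and for `n = 2` these are the corners `T, TfA, …` of
`Census/HalfParityExampleQ8.lean`.

CONTENT (all `n ≥ 1`).
* §1 `c`, its square, non-triviality, centrality; the arcs and the biarc types (`a_mem_barc`, `xa_mem_barc`).
* §2 **Base change of biarcs** (`rt_a_barc`: `barc p q · (a k)⁻¹ = barc (p−k) (q−k)`; `rt_xa_barc`: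
  `barc p q · (xa k)⁻¹ = barc (k−q+n+1) (k−p+1)`), so the biarcs form `n` free blocks indexed by `p − q (mod n)`; the complement
  `barc p q · c = barc (p+n) (q+n)` and **the half-turn partner** `barc p (q+n) = barc p q · (xa (p+q−n−1))⁻¹` (`barc_add_n_eq_rt`), along an
  element of square `c` (`xa_mul_xa_self`) — the input of the ORDER-FOUR TRICK of part J.
* §3 **Flips of biarcs at their four ends** are biarcs (`oflipCM_a_barc`, `oflipCM_a_last_barc`, `oflipCM_xa_barc`, `oflipCM_xa_last_barc`).
* §4 **The biarc face** `fplus p q = gface (barc p q) (a p) (xa (q−1)) = [p,q] + [p+1,q−1] − [p+1,q] − [p,q−1]` (`fplus_eq`), a member of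
  `gfaceSet` (`fplus_mem_gfaceSet`), and its base changes `fplus p q · (a k)⁻¹ = fplus (p−k) (q−k)` (`mapDomain_rt_a_fplus`): one `G`-orbit of
  biarc faces per residue `p − q (mod n)`.
Parts II (`Census/QuaternionColumnCircle.lean`: `2·[barc p q]` lies in the target lattice of the `n` biarc face orbits) and III (the chains of
the interior single flips) build the complete residual reduction of the quaternion column on this file.

## References
* [Pohlmann1968] H. Pohlmann, Algebraic cycles on abelian varieties of complex multiplication type, Ann. of Math. 88 (1968), Thm 1.
-/

namespace Summit.HodgeConjecture.CorCM.Census.QuaternionColumn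

open Finset QuaternionGroup
open Summit.HodgeConjecture.CorCM.Prior.AllgGroup.RfwfAllgGroup
open Summit.HodgeConjecture.CorCM.Census.BlockParity
open Summit.HodgeConjecture.CorCM.Census.TwistGeneration

noncomputable section

variable {n : ℕ} [NeZero n]

/-! ## §1 The group `Q_{4n}`, its central involution, and the biarc types -/

/-- **The central involution** `c = a n` of `Q_{4n}` (`= x²`). [folklore] -/
def c (n : ℕ) : QuaternionGroup n := a n

omit [NeZero n] in
/-- `2n = 0` in `ℤ/2n`. [folklore] -/
theorem two_n_eq_zero : (n : ZMod (2 * n)) + (n : ZMod (2 * n)) = 0 := n_add_n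

omit [NeZero n] in
/-- `−n = n` in `ℤ/2n`: `r − n = r + n`. [folklore] -/
theorem sub_n_eq_add_n (r : ZMod (2 * n)) : r - (n : ZMod (2 * n)) = r + (n : ZMod (2 * n)) := by
  rw [sub_eq_iff_eq_add, add_assoc, two_n_eq_zero, add_zero]

/-- `n ≠ 0` in `ℤ/2n` (`n ≥ 1`). [folklore] -/
theorem natCast_n_ne_zero : (n : ZMod (2 * n)) ≠ 0 := by
  intro h
  have h2 := congrArg ZMod.val h
  rw [val_n, ZMod.val_zero] at h2
  exact NeZero.ne n h2

/-- `p ≠ p + n` in `ℤ/2n`. [folklore] -/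
theorem self_ne_add_n (p : ZMod (2 * n)) : p ≠ p + (n : ZMod (2 * n)) := by
  intro h
  exact natCast_n_ne_zero (n := n) (by linear_combination -h)

omit [NeZero n] in
/-- `c² = 1`. [folklore] -/
theorem c_mul_c : c n * c n = 1 := by
  rw [c, a_mul_a, two_n_eq_zero, ← one_def]

/-- `c ≠ 1` (`n ≥ 1`). [folklore] -/
theorem c_ne_one : c n ≠ 1 := by
  rw [c, one_def]
  intro h
  exact natCast_n_ne_zero (QuaternionGroup.a.inj h)

omit [NeZero n] in
/-- `c` is central. [folklore] -/
theorem c_comm : ∀ x : QuaternionGroup n, x * c n = c n * x := by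
  intro x
  cases x with
  | a i => rw [c, a_mul_a, a_mul_a, add_comm]
  | xa i =>
    rw [c, xa_mul_a, a_mul_xa, sub_n_eq_add_n]

omit [NeZero n] in
/-- `c · a i = a (i + n)` and `c · xa j = xa (j + n)`. [folklore] -/
theorem c_mul_a (i : ZMod (2 * n)) : c n * a i = a (i + (n : ZMod (2 * n))) ∧ c n * xa i = xa (i + (n : ZMod (2 * n))) := by
  refine ⟨by rw [c, a_mul_a, add_comm], ?_⟩
  rw [c, a_mul_xa, sub_n_eq_add_n]

/-- The rotation index of an element: `idx (a i) = i`, `idx (xa j) = j`. [folklore] -/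
def idx : QuaternionGroup n → ZMod (2 * n)
  | a i => i
  | xa j => j

/-- The coset indicator: `isA (a i) = true`, `isA (xa j) = false`. [folklore] -/
def isA : QuaternionGroup n → Bool
  | a _ => true
  | xa _ => false

/-- The underlying set of the biarc type `barc p q = {a p, …, a (p+n−1)} ⊔ {xa q, …, xa (q+n−1)}`. [folklore] -/
def barcSet (p q : ZMod (2 * n)) : Finset (QuaternionGroup n) :=
  univ.filter fun g => (idx g - (if isA g then p else q)).val < n

/-- `a i ∈ barc p q ↔ (i − p).val < n`. [folklore] -/
@[simp] theorem a_mem_barcSet (p q i : ZMod (2 * n)) : a i ∈ barcSet p q ↔ (i - p).val < n := by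
  simp [barcSet, idx, isA]

/-- `xa j ∈ barc p q ↔ (j − q).val < n`. [folklore] -/
@[simp] theorem xa_mem_barcSet (p q j : ZMod (2 * n)) : xa j ∈ barcSet p q ↔ (j - q).val < n := by
  simp [barcSet, idx, isA]

/-- The biarc set is a CM type: it contains exactly one of `g`, `c·g`. [folklore] -/
theorem isCMF_barcSet (p q : ZMod (2 * n)) : IsCMF (c n) (barcSet p q) := by
  intro g
  cases g with
  | a i =>
    rw [(c_mul_a i).1, a_mem_barcSet, a_mem_barcSet, show i + (n : ZMod (2 * n)) - p = (i - p) + (n : ZMod (2 * n)) by ring]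
    exact lt_iff_not_lt_add_n _
  | xa j =>
    rw [(c_mul_a j).2, xa_mem_barcSet, xa_mem_barcSet, show j + (n : ZMod (2 * n)) - q = (j - q) + (n : ZMod (2 * n)) by ring]
    exact lt_iff_not_lt_add_n _

/-- **The biarc type** `barc p q`. [folklore] -/
def barc (p q : ZMod (2 * n)) : CMF (QuaternionGroup n) (c n) := ⟨barcSet p q, isCMF_barcSet p q⟩

/-- Membership of a rotation in a biarc. [folklore] -/
@[simp] theorem a_mem_barc (p q i : ZMod (2 * n)) : a i ∈ (barc p q).1 ↔ (i - p).val < n := a_mem_barcSet p q i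

/-- Membership of a reflection in a biarc. [folklore] -/
@[simp] theorem xa_mem_barc (p q j : ZMod (2 * n)) : xa j ∈ (barc p q).1 ↔ (j - q).val < n := xa_mem_barcSet p q j

/-- Two CM types of `Q_{4n}` are equal iff they contain the same rotations and the same reflections. [folklore] -/
theorem ext_of_a_xa {Φ Ψ : CMF (QuaternionGroup n) (c n)} (ha : ∀ i, a i ∈ Φ.1 ↔ a i ∈ Ψ.1) (hx : ∀ j, xa j ∈ Φ.1 ↔ xa j ∈ Ψ.1) :
    Φ = Ψ := by
  apply Subtype.ext; ext g
  cases g with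
  | a i => exact ha i
  | xa j => exact hx j

/-! ## §2 Base change of biarcs -/

/-- **Base change along a rotation**: `barc p q · (a k)⁻¹ = barc (p − k) (q − k)`. [folklore] -/
theorem rt_a_barc (k p q : ZMod (2 * n)) : rt (c n) (a k) (barc p q) = barc (p - k) (q - k) := by
  refine ext_of_a_xa (fun i => ?_) (fun j => ?_)
  · rw [mem_rt, a_mul_a, a_mem_barc, a_mem_barc, show i + k - p = i - (p - k) by ring]
  · rw [mem_rt, xa_mul_a, xa_mem_barc, xa_mem_barc, show j + k - q = j - (q - k) by ring]

/-- The arc condition is symmetric under `t ↦ m − t` up to the shift by `n − 1`: `(k − i − q).val < n ↔ (i − (k − q + n + 1)).val < n`.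
[folklore] -/
theorem val_sub_lt_iff_reflect (k i q : ZMod (2 * n)) : (k - i - q).val < n ↔ (i - (k - q + (n : ZMod (2 * n)) + 1)).val < n := by
  have h2n : 0 < 2 * n := by have := NeZero.ne n; omega
  set v : ZMod (2 * n) := k - i - q with hv
  have e : i - (k - q + (n : ZMod (2 * n)) + 1) = -v + (n : ZMod (2 * n)) - 1 := by
    rw [hv]; linear_combination (-1 : ZMod (2 * n)) * two_n_eq_zero (n := n)
  rw [e]
  -- `(-v + n - 1).val < n ↔ v.val < n`: both say `v ∈ {0, …, n−1}`
  have key : ∀ w : ZMod (2 * n), w.val < n → (-w + (n : ZMod (2 * n)) - 1).val < n := by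
    intro w hw
    have e1 : -w + (n : ZMod (2 * n)) - 1 = (((n - 1 - w.val : ℕ)) : ZMod (2 * n)) := by
      rw [Nat.cast_sub (by omega), Nat.cast_sub (by have := NeZero.ne n; omega), ZMod.natCast_zmod_val, Nat.cast_one]; ring
    rw [e1, ZMod.val_cast_of_lt (by omega)]
    omega
  constructor
  · exact key v
  · intro h
    by_contra h'
    -- then `(v + n).val < n`, and `key` applied to `v + n` gives `(-v - 1).val < n`, contradicting antipodality with `-v + n - 1`
    have h1 : (v + (n : ZMod (2 * n))).val < n := by
      have := (lt_iff_not_lt_add_n v); tauto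
    have h2 := key (v + (n : ZMod (2 * n))) h1
    rw [show -(v + (n : ZMod (2 * n))) + (n : ZMod (2 * n)) - 1 = (-v + (n : ZMod (2 * n)) - 1) + (n : ZMod (2 * n)) by
      linear_combination (-1 : ZMod (2 * n)) * two_n_eq_zero (n := n)] at h2
    exact ((lt_iff_not_lt_add_n (-v + (n : ZMod (2 * n)) - 1)).mp h) h2

/-- **Base change along a reflection**: `barc p q · (xa k)⁻¹ = barc (k − q + n + 1) (k − p + 1)`. [folklore] -/
theorem rt_xa_barc (k p q : ZMod (2 * n)) : rt (c n) (xa k) (barc p q) = barc (k - q + (n : ZMod (2 * n)) + 1) (k - p + 1) := by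
  refine ext_of_a_xa (fun i => ?_) (fun j => ?_)
  · rw [mem_rt, a_mul_xa, xa_mem_barc, a_mem_barc]
    exact val_sub_lt_iff_reflect k i q
  · rw [mem_rt, xa_mul_xa, a_mem_barc, xa_mem_barc, show (n : ZMod (2 * n)) + k - j - p = (k + (n : ZMod (2 * n))) - j - p by ring,
      val_sub_lt_iff_reflect, show k + (n : ZMod (2 * n)) - p + (n : ZMod (2 * n)) + 1 = k - p + 1 + ((n : ZMod (2 * n)) + (n : ZMod (2 * n))) by ring, two_n_eq_zero, add_zero]

/-- **The conjugate biarc**: `barc p q · c = barc (p + n) (q + n)`. [folklore] -/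
theorem rt_c_barc (p q : ZMod (2 * n)) : rt (c n) (c n) (barc p q) = barc (p + (n : ZMod (2 * n))) (q + (n : ZMod (2 * n))) := by
  change rt (c n) (a (n : ZMod (2 * n))) (barc p q) = _
  rw [rt_a_barc, sub_n_eq_add_n, sub_n_eq_add_n]

omit [NeZero n] in
/-- A reflection squares to `c`: `(xa k)² = c`. [folklore] -/
theorem xa_mul_xa_self (k : ZMod (2 * n)) : xa k * xa k = c n := by
  rw [xa_mul_xa, c, add_sub_cancel_right]

/-- **The half-turn partner of a biarc is a base change along an element of square `c`**:
`barc p (q + n) = barc p q · (xa (p + q − n − 1))⁻¹`. [folklore] -/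
theorem barc_add_n_eq_rt (p q : ZMod (2 * n)) : barc p (q + (n : ZMod (2 * n))) = rt (c n) (xa (p + q - (n : ZMod (2 * n)) - 1)) (barc p q) := by
  rw [rt_xa_barc]
  congr 1
  · ring
  · linear_combination two_n_eq_zero (n := n)

/-- The other half-turn partner: `barc (p + n) q = barc p q · (xa (p + q − 1))⁻¹`. [folklore] -/
theorem barc_add_n_left_eq_rt (p q : ZMod (2 * n)) : barc (p + (n : ZMod (2 * n))) q = rt (c n) (xa (p + q - 1)) (barc p q) := by
  rw [rt_xa_barc]
  congr 1 <;> ring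

/-- Biarcs with the same difference `p − q` are base changes of each other along rotations: `barc p q = barc (p + k) (q + k) · (a k)⁻¹`.
[folklore] -/
theorem barc_eq_rt_a (p q k : ZMod (2 * n)) : barc p q = rt (c n) (a k) (barc (p + k) (q + k)) := by
  rw [rt_a_barc, add_sub_cancel_right, add_sub_cancel_right]

/-! ## §3 Flips of biarcs at their ends -/

/-- `val 1 = 1` in `ℤ/2n` for `n ≥ 1`. [folklore] -/
theorem val_one_eq : (1 : ZMod (2 * n)).val = 1 := by
  have := NeZero.ne n
  haveI : Fact (1 < 2 * n) := ⟨by omega⟩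
  exact ZMod.val_one (2 * n)

/-- The successor step inside an arc: `(v + 1).val < n ↔ (v.val < n ∧ v.val + 1 ≠ n) ∨ v = -1`. Stated as the two membership transfers we
need: if `v.val < n` and `v.val + 1 < n` then `(v+1).val < n`; if `(v + 1).val < n` and `v + 1 ≠ 0` then `v.val < n`. [folklore] -/
theorem val_add_one_of_lt {v : ZMod (2 * n)} (h : v.val + 1 < n) : (v + 1).val = v.val + 1 := by
  have := NeZero.ne n
  rw [ZMod.val_add, val_one_eq, Nat.mod_eq_of_lt (by omega)]

/-- `val` of a predecessor: if `v ≠ 0` then `(v − 1).val = v.val − 1`. [folklore] -/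
theorem val_sub_one_of_ne {v : ZMod (2 * n)} (h : v ≠ 0) : (v - 1).val = v.val - 1 := by
  have hv : 1 ≤ v.val := by
    rw [Nat.one_le_iff_ne_zero]
    intro h0
    exact h ((ZMod.val_eq_zero v).mp h0)
  rw [ZMod.val_sub (by rw [val_one_eq]; exact hv), val_one_eq]

/-- `(-1).val = 2n − 1`. [folklore] -/
theorem val_neg_one : (-1 : ZMod (2 * n)).val = 2 * n - 1 := by
  have := NeZero.ne n
  rw [ZMod.neg_val, if_neg (by
    intro h
    have h' := congrArg ZMod.val h
    rw [val_one_eq, ZMod.val_zero] at h'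
    exact one_ne_zero h'), val_one_eq]

/-- **Membership in the successor arc**: `(i − (p+1)).val < n ↔ ((i − p).val < n ∧ i ≠ p) ∨ i = p + n`. [folklore] -/
theorem mem_arc_succ_iff (i p : ZMod (2 * n)) : (i - (p + 1)).val < n ↔ ((i - p).val < n ∧ i ≠ p) ∨ i = p + (n : ZMod (2 * n)) := by
  have hn := NeZero.ne n
  set v := i - p with hv
  have e : i - (p + 1) = v - 1 := by rw [hv]; ring
  rw [e]
  have hi : i = p + (n : ZMod (2 * n)) ↔ v = (n : ZMod (2 * n)) := by
    rw [hv]; constructor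
    · intro h; rw [h]; ring
    · intro h; linear_combination h
  have hi' : i ≠ p ↔ v ≠ 0 := by rw [hv, sub_ne_zero]
  rw [hi, hi']
  by_cases h0 : v = 0
  · rw [h0, zero_sub, val_neg_one]
    constructor
    · intro h; exact absurd h (by omega)
    · rintro (⟨-, h⟩ | h)
      · exact absurd rfl h
      · have h' := congrArg ZMod.val h
        rw [ZMod.val_zero, val_n] at h'
        exact absurd h'.symm hn
  · rw [val_sub_one_of_ne h0]
    have hvlt := ZMod.val_lt v
    constructor
    · intro h
      by_cases hvn : v.val < n
      · exact Or.inl ⟨hvn, h0⟩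
      · right
        have : v.val = n := by omega
        rw [← ZMod.natCast_zmod_val v, this]
    · rintro (⟨h, -⟩ | h)
      · omega
      · rw [h, val_n]; omega

/-- The propositional pattern of a flip at an arc end: with `A = «inside the arc»`, `i = p` inside and `i = p + n` outside. [folklore] -/
theorem flip_iff_helper {A : Prop} {i p : ZMod (2 * n)} (hA1 : i = p → A) (hA2 : i = p + (n : ZMod (2 * n)) → ¬A) :
    (¬(A ↔ (i = p ∨ i = p + (n : ZMod (2 * n))))) ↔ ((A ∧ i ≠ p) ∨ i = p + (n : ZMod (2 * n))) := by
  have hpn := self_ne_add_n p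
  by_cases h1 : i = p
  · have hA := hA1 h1
    have h2 : i ≠ p + (n : ZMod (2 * n)) := by rw [h1]; exact hpn
    tauto
  · by_cases h2 : i = p + (n : ZMod (2 * n))
    · have hA := hA2 h2; tauto
    · tauto

/-- Inside/outside facts at the two ends: `(p − p).val < n` and `¬ (p + n − p).val < n`. [folklore] -/
theorem val_self_sub_lt (p : ZMod (2 * n)) : (p - p).val < n ∧ ¬ (p + (n : ZMod (2 * n)) - p).val < n := by
  refine ⟨?_, ?_⟩
  · rw [sub_self, ZMod.val_zero]; exact Nat.pos_of_ne_zero (NeZero.ne n)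
  · rw [add_sub_cancel_left, val_n]; exact lt_irrefl n

/-- **Flipping a biarc at the start of its rotation arc**: `(barc p q)^{(a p)} = barc (p + 1) q`. [folklore] -/
theorem oflipCM_a_barc (p q : ZMod (2 * n)) : oflipCM (c n) c_mul_c (a p) (barc p q) = barc (p + 1) q := by
  refine ext_of_a_xa (fun i => ?_) (fun j => ?_)
  · rw [mem_oflipCM_iff' c_mul_c, a_mem_barc, a_mem_barc, mem_orb, (c_mul_a p).1, mem_arc_succ_iff]
    have h1 : (a i : QuaternionGroup n) = a p ↔ i = p := ⟨fun h => QuaternionGroup.a.inj h, fun h => by rw [h]⟩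
    have h2 : (a i : QuaternionGroup n) = a (p + (n : ZMod (2 * n))) ↔ i = p + (n : ZMod (2 * n)) := ⟨fun h => QuaternionGroup.a.inj h, fun h => by rw [h]⟩
    rw [h1, h2]
    exact flip_iff_helper (fun h => by rw [h]; exact (val_self_sub_lt p).1) (fun h => by rw [h]; exact (val_self_sub_lt p).2)
  · rw [mem_oflipCM_iff' c_mul_c, xa_mem_barc, xa_mem_barc, mem_orb, (c_mul_a p).1]
    have h1 : (xa j : QuaternionGroup n) ≠ a p := fun h => by cases h
    have h2 : (xa j : QuaternionGroup n) ≠ a (p + (n : ZMod (2 * n))) := fun h => by cases h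
    simp only [h1, h2, or_self, iff_false, not_not]

/-- **Flipping a biarc at the end of its rotation arc**: `(barc p q)^{(a (p+n−1))} = barc (p − 1) q` (the place of `a (p − 1) = c·a (p+n−1)`).
[folklore] -/
theorem oflipCM_a_last_barc (p q : ZMod (2 * n)) : oflipCM (c n) c_mul_c (a (p - 1)) (barc p q) = barc (p - 1) q := by
  have h := oflipCM_a_barc (n := n) (p - 1) q
  rw [sub_add_cancel] at h
  rw [← h, oflipCM_oflipCM_self]

/-- The successor-arc lemma read for reflections: flipping at the start of the reflection arc. [folklore] -/
theorem oflipCM_xa_barc (p q : ZMod (2 * n)) : oflipCM (c n) c_mul_c (xa q) (barc p q) = barc p (q + 1) := by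
  refine ext_of_a_xa (fun i => ?_) (fun j => ?_)
  · rw [mem_oflipCM_iff' c_mul_c, a_mem_barc, a_mem_barc, mem_orb, (c_mul_a q).2]
    have h1 : (a i : QuaternionGroup n) ≠ xa q := fun h => by cases h
    have h2 : (a i : QuaternionGroup n) ≠ xa (q + (n : ZMod (2 * n))) := fun h => by cases h
    simp only [h1, h2, or_self, iff_false, not_not]
  · rw [mem_oflipCM_iff' c_mul_c, xa_mem_barc, xa_mem_barc, mem_orb, (c_mul_a q).2, mem_arc_succ_iff]
    have h1 : (xa j : QuaternionGroup n) = xa q ↔ j = q := ⟨fun h => QuaternionGroup.xa.inj h, fun h => by rw [h]⟩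
    have h2 : (xa j : QuaternionGroup n) = xa (q + (n : ZMod (2 * n))) ↔ j = q + (n : ZMod (2 * n)) := ⟨fun h => QuaternionGroup.xa.inj h, fun h => by rw [h]⟩
    rw [h1, h2]
    exact flip_iff_helper (fun h => by rw [h]; exact (val_self_sub_lt q).1) (fun h => by rw [h]; exact (val_self_sub_lt q).2)

/-- Flipping a biarc at the end of its reflection arc: `(barc p q)^{(xa (q−1))} = barc p (q − 1)`. [folklore] -/
theorem oflipCM_xa_last_barc (p q : ZMod (2 * n)) : oflipCM (c n) c_mul_c (xa (q - 1)) (barc p q) = barc p (q - 1) := by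
  have h := oflipCM_xa_barc (n := n) p (q - 1)
  rw [sub_add_cancel] at h
  rw [← h, oflipCM_oflipCM_self]

/-! ## §4 The biarc faces -/

/-- **The biarc face** `fplus p q = gface (barc p q) (a p) (xa (q − 1))` (flip the start of the rotation arc and the end of the reflection arc).
[folklore] -/
def fplus (p q : ZMod (2 * n)) : CMF (QuaternionGroup n) (c n) →₀ ℤ := gface (c n) c_mul_c (barc p q) (a p) (xa (q - 1))

/-- **The four corners of the biarc face**: `fplus p q = [p,q] + [p+1,q−1] − [p+1,q] − [p,q−1]`. [folklore] -/
theorem fplus_eq (p q : ZMod (2 * n)) : fplus p q =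
    Finsupp.single (barc p q) 1 + Finsupp.single (barc (p + 1) (q - 1)) 1 - Finsupp.single (barc (p + 1) q) 1 -
      Finsupp.single (barc p (q - 1)) 1 := by
  rw [fplus, gface, oflipCM_xa_last_barc, oflipCM_a_barc, oflipCM_a_barc]

omit [NeZero n] in
/-- The two places of the biarc face are distinct places. [folklore] -/
theorem xa_notMem_orb_a (p j : ZMod (2 * n)) : (xa j : QuaternionGroup n) ∉ orb (c n) (a p) := by
  rw [mem_orb, (c_mul_a p).1]
  rintro (h | h) <;> cases h

/-- **The biarc face is a face relation** (a member of `gfaceSet`). [folklore] -/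
theorem fplus_mem_gfaceSet (p q : ZMod (2 * n)) : fplus p q ∈ gfaceSet (QuaternionGroup n) (c n) c_mul_c :=
  ⟨barc p q, a p, xa (q - 1), xa_notMem_orb_a p (q - 1), rfl⟩

/-- **Base change of the biarc face along a rotation**: `fplus p q · (a k)⁻¹ = fplus (p − k) (q − k)`. [folklore] -/
theorem mapDomain_rt_a_fplus (k p q : ZMod (2 * n)) :
    Finsupp.mapDomain (rt (c n) (a k)) (fplus p q) = fplus (p - k) (q - k) := by
  rw [fplus, mapDomain_rt_gface, rt_a_barc, fplus]
  have h1 : (a p : QuaternionGroup n) * (a k)⁻¹ = a (p - k) := by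
    rw [show (a k : QuaternionGroup n)⁻¹ = a (-k) from rfl, a_mul_a, sub_eq_add_neg]
  have h2 : (xa (q - 1) : QuaternionGroup n) * (a k)⁻¹ = xa (q - k - 1) := by
    rw [show (a k : QuaternionGroup n)⁻¹ = a (-k) from rfl, xa_mul_a]
    congr 1; ring
  rw [h1, h2]

/-- Every biarc face is a base change of the one with the same difference at `p = 0`: `fplus p q = (fplus 0 (q − p)) · (a (−p))⁻¹`.
[folklore] -/
theorem fplus_eq_mapDomain (p q : ZMod (2 * n)) :
    fplus p q = Finsupp.mapDomain (rt (c n) (a (-p))) (fplus 0 (q - p)) := by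
  rw [mapDomain_rt_a_fplus]
  congr 1 <;> ring

end

end Summit.HodgeConjecture.CorCM.Census.QuaternionColumn
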